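import Summits.NavierStokesRegularity.NavierStokesRegularity.Theses.FilamentSkeletonRss

/-!
# Route `FilamentSkeletonRss` · crux `TransverseReductionRJ` (stmt-NavierStokesRegularity-21221) — line `kelvin_gate`:
# shared VOCABULARY of the registered skeleton (definitions + the kernel-checked composition)

HONEST FRAMING.  Bookkeeping for a HYPOTHETICAL filament-type rotating-self-similar (RSS) blow-up route
(`route-NavierStokesRegularity-FilamentSkeletonRss`, refutation side).  Nothing in this file moves Navier–Stokes
regularity.  This file contains NO stub and NO claim: it is the sorry-free part of the registered line
`Cruxes/TransverseReductionRJ/Lines/kelvin_gate.lean` (planner ns-filament-repair-plan g4, typing v3, sha16 c9f003954f208bf6;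
registered 2026-08-28 by seat ns-filament-21221-p1, commits acffea9099e6 / e58e8a42bf00, `ledger skeleton check` OK:
stubs `stub_dressedSkeleton`, `stub_kelvinGate`, `stub_nonlinearClosing`, `stub_ellipticSmoothing`), made IMPORTABLE so
that the stub helper files of the line (`--supports stmt-NavierStokesRegularity-21221`) can state the registered stub
signatures BY NAME (a `Theorems/` file may not import a `Cruxes/…/Lines/` workfile, which carries `sorry`).

Contents (byte-identical bodies to the Lines file; only the namespace differs —
`…Theorems.KelvinGate.X` here vs `…Cruxes.TransverseReductionRJ.KelvinGate.X` there, so the two copies of every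
statement are definitionally equal by `Iff.rfl`):
* §1 the crux `TransverseReductionRJ` cut at its arrows (`DefU`, `DefV`, `DefA`, `DefT`, `DefD`, `BoxClausesJ`,
  `AdmissibleJ`, certified by `transverseReductionRJ_iff := Iff.rfl`);
* §2 the analytic vocabulary of the line (`lerayOp`, `lerayLin`, `XBound`, `YBound`, `LocClose`, `baseRes`,
  `BaseSpec`, `GateSpec`, `AlmostAdmissibleJ`);
* §3 the four stub STATEMENTS `DressedSkeletonAllOrders` (S1), `PolynomialKelvinGate` (S2, kill-first),
  `NonlinearClosing` (S3), `EllipticSmoothing` (S4) — as `def … : Prop`, never asserted;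
* §4 the COMPOSITION `TransverseReductionRJ_of : S1 → S2 → S3 → S4 → TransverseReductionRJ` (pure logic, proved; the
  crux BY NAME).

What is deliberately NOT here: the sorried `stub_*` theorems and `transverseReductionRJ_from_line` (they stay in the
Lines workfile); any proof of a stub.
-/

set_option linter.dupNamespace false

noncomputable section

namespace Summit.NavierStokesRegularity.NavierStokesRegularity.Theorems.KelvinGate

open scoped BigOperators Topology Manifold Classical MeasureTheory ProbabilityTheory Matrix InnerProductSpace ComplexConjugate ContinuousMap ENNReal
open Filter Set Function TopologicalSpace MeasureTheory
open Literature.NS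
open Literature.Analysis.FluidPDE
open Summit.NavierStokesRegularity.NavierStokesRegularity.Theses.FilamentSkeletonRss


/-! ## 1. The crux, cut at its arrows (texts VERBATIM from the route decl `TransverseReductionRJ`, l.403 of the route file) -/

/-- Defining hypothesis 1 of `TransverseReductionRJ`: `u` is the regularised Biot–Savart field of a filament family. -/
def DefU (N : ℕ) (Γ : ℝ) (γ : (Fin N → ℝ) → Fin N → ℝ) (u : (Fin N → ℝ) → (Fin N → ℝ → EuclideanSpace ℝ (Fin 3)) → EuclideanSpace ℝ (Fin 3) → EuclideanSpace ℝ (Fin 3)) : Prop :=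
  ∀ p Z y, u p Z y = ∑ k, (Γ*γ p k/(4*Real.pi))•∫ σ:ℝ, ((‖y-Z k σ‖^2+1)^(3/2:ℝ))⁻¹•cross (deriv (Z k) σ) (y-Z k σ)

/-- Defining hypothesis 2: the frame field `v = u(X) + ½y − α e₃ × y`. -/
def DefV (N : ℕ) (α : (Fin N → ℝ) → ℝ) (X : (Fin N → ℝ) → Fin N → ℝ → EuclideanSpace ℝ (Fin 3)) (u : (Fin N → ℝ) → (Fin N → ℝ → EuclideanSpace ℝ (Fin 3)) → EuclideanSpace ℝ (Fin 3) → EuclideanSpace ℝ (Fin 3)) (v : (Fin N → ℝ) → EuclideanSpace ℝ (Fin 3) → EuclideanSpace ℝ (Fin 3)) : Prop :=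
  ∀ p y, v p y = u p (X p) y+(1/2:ℝ)•y-α p•cross (EuclideanSpace.single 2 1) y

/-- Defining hypothesis 3: the waist gradients `A_pj = Dv_p(X_pj(c_pj))`. -/
def DefA (N : ℕ) (X : (Fin N → ℝ) → Fin N → ℝ → EuclideanSpace ℝ (Fin 3)) (c : (Fin N → ℝ) → Fin N → ℝ) (v : (Fin N → ℝ) → EuclideanSpace ℝ (Fin 3) → EuclideanSpace ℝ (Fin 3)) (A : (Fin N → ℝ) → Fin N → (EuclideanSpace ℝ (Fin 3) →L[ℝ] EuclideanSpace ℝ (Fin 3))) : Prop :=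
  ∀ p j, A p j = fderiv ℝ (v p) (X p j (c p j))

/-- Defining hypothesis 4: the normal-tangency residual `T`. -/
def DefT (N : ℕ) (α : (Fin N → ℝ) → ℝ) (u : (Fin N → ℝ) → (Fin N → ℝ → EuclideanSpace ℝ (Fin 3)) → EuclideanSpace ℝ (Fin 3) → EuclideanSpace ℝ (Fin 3)) (T : (Fin N → ℝ) → (Fin N → ℝ → EuclideanSpace ℝ (Fin 3)) → Fin N → ℝ → EuclideanSpace ℝ (Fin 3)) : Prop :=
  ∀ p Z j τ, T p Z j τ = (u p Z (Z j τ)+(1/2:ℝ)•Z j τ-α p•cross (EuclideanSpace.single 2 1) (Z j τ))-(⟪u p Z (Z j τ)+(1/2:ℝ)•Z j τ-α p•cross (EuclideanSpace.single 2 1) (Z j τ), deriv (Z j) τ⟫_ℝ/‖deriv (Z j) τ‖^2)•deriv (Z j) τ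

/-- Defining hypothesis 5: the accretion modes `D_pj`. -/
def DefD (N : ℕ) (X : (Fin N → ℝ) → Fin N → ℝ → EuclideanSpace ℝ (Fin 3)) (c : (Fin N → ℝ) → Fin N → ℝ) (D : (Fin N → ℝ) → Fin N → EuclideanSpace ℝ (Fin 3) → EuclideanSpace ℝ (Fin 3)) : Prop :=
  ∀ p j y, D p j y = (Real.exp (-(⟪y-X p j (c p j), deriv (X p j) (c p j)⟫_ℝ)^2)*((1-Real.exp (-(‖y-X p j (c p j)‖^2-⟪y-X p j (c p j), deriv (X p j) (c p j)⟫_ℝ^2)))/(‖y-X p j (c p j)‖^2-⟪y-X p j (c p j), deriv (X p j) (c p j)⟫_ℝ^2)))•cross (deriv (X p j) (c p j)) (y-X p j (c p j))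

/-- The K1‴ ball-box clauses 0–13J of `TransverseReductionRJ` (= those of `SelectionBoxRJ`), VERBATIM. -/
def BoxClausesJ (N : ℕ) (Γ δ ρ K Λ a b cnd Rw Rb cg θ₀ : ℝ) (γ : (Fin N → ℝ) → Fin N → ℝ) (α : (Fin N → ℝ) → ℝ) (X : (Fin N → ℝ) → Fin N → ℝ → EuclideanSpace ℝ (Fin 3)) (w : (Fin N → ℝ) → Fin N → ℝ → ℝ) (c : (Fin N → ℝ) → Fin N → ℝ) (m : (Fin N → ℝ) → Fin N → EuclideanSpace ℝ (Fin 3)) (n : (Fin N → ℝ) → Fin N → EuclideanSpace ℝ (Fin 3)) (v : (Fin N → ℝ) → EuclideanSpace ℝ (Fin 3) → EuclideanSpace ℝ (Fin 3)) (A : (Fin N → ℝ) → Fin N → (EuclideanSpace ℝ (Fin 3) →L[ℝ] EuclideanSpace ℝ (Fin 3))) (T : (Fin N → ℝ) → (Fin N → ℝ → EuclideanSpace ℝ (Fin 3)) → Fin N → ℝ → EuclideanSpace ℝ (Fin 3)) : Prop :=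
  (∀ j, ContinuousOn (fun q:(Fin N→ℝ) × ℝ => (α q.1, γ q.1 j, X q.1 j q.2, w q.1 j q.2)) ({p:Fin N → ℝ | ∀ i, p i ∈ Icc 0 1} ×ˢ univ))∧(∀ p:Fin N → ℝ, (∀ i, p i ∈ Icc 0 1) → α p ≠ 0 ∧ (∀ j, γ p j ≠ 0)∧(∀ j, ContDiff ℝ 2 (X p j) ∧ Differentiable ℝ (w p j)∧(∀ τ, ‖deriv (X p j) τ‖ = 1)∧(∀ τ, ‖iteratedDeriv 2 (X p j) τ‖*√Γ≤K) ∧ Tendsto (fun τ => ‖X p j τ‖) (cocompact ℝ) atTop)∧(∀ j k, j ≠ k → ∀ τ σ, ρ*√Γ≤‖X p j τ-X p k σ‖)∧(∀ j τ σ, ρ*√Γ≤|τ-σ| → cg*ρ*√Γ≤‖X p j τ-X p j σ‖)∧(∀ j τ, cg*|τ-c p j|≤Rw*√Γ+‖X p j τ‖)∧(∀ j τ, w p j τ = ⟪v p (X p j τ), deriv (X p j) τ⟫_ℝ)∧(∀ j τ, ‖X p j τ‖≤Rb*√(Γ*Real.log Γ) → v p (X p j τ) = w p j τ•deriv (X p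 j) τ)∧(∀ j, ‖X p j (c p j)‖≤Rw*√Γ)∧(∀ j, |⟪deriv (X p j) (c p j), EuclideanSpace.single 2 1⟫_ℝ|≤1-θ₀)∧(θ₀≤|α p| ∧ |α p|≤θ₀⁻¹ ∧ ∀ j, θ₀≤|γ p j| ∧ |γ p j|≤θ₀⁻¹)∧(∀ j, w p j (c p j) = 0 ∧ (∀ τ, w p j τ = 0 → τ = c p j) ∧ 3/2+δ≤deriv (w p j) (c p j) ∧ deriv (w p j) (c p j)≤Λ)∧(∀ j, Orthonormal ℝ ![deriv (X p j) (c p j), m p j, n p j] ∧ ⟪A p j (m p j), m p j⟫_ℝ+⟪A p j (n p j), n p j⟫_ℝ < 0 ∧ ⟪A p j (n p j), m p j⟫_ℝ * ⟪A p j (m p j), n p j⟫_ℝ < ⟪A p j (m p j), m p j⟫_ℝ * ⟪A p j (n p j), n p j⟫_ℝ)∧(∀ Y:Fin N → ℝ → EuclideanSpace ℝ (Fin 3), (∀ j, ContDiff ℝ 2 (Y j))→(∀ j τ, ⟪Y j τ, deriv (X p j) τ⟫_ℝ = 0) → (∀ j τ, Rb*√(Γ*Real.log Γ) < ‖X p j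 τ‖ → Y j τ = 0) → ∑ j, ⟪Y j (c p j), cross (EuclideanSpace.single 2 1) (X p j (c p j))⟫_ℝ = 0 → (∀ j τ, ‖Y j τ‖+‖deriv (Y j) τ‖+‖iteratedDeriv 2 (Y j) τ‖≤(1+|τ-c p j|)^b) → ∀ L:ℝ, (∀ j τ, ‖deriv (fun s:ℝ => T p (fun k σ => X p k σ+s•Y k σ) j τ) 0‖≤L*(1+|τ-c p j|)^a) → ∀ j τ, ‖Y j τ‖≤cnd*L*(1+|τ-c p j|)^b))

/-- The conclusion block of `TransverseReductionRJ`: an ADMISSIBLE reduced family `(C₀, M, U, P, B)`, VERBATIM. -/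
def AdmissibleJ (N : ℕ) (Γ ρ η Rw : ℝ) (α : (Fin N → ℝ) → ℝ) (X : (Fin N → ℝ) → Fin N → ℝ → EuclideanSpace ℝ (Fin 3)) (u : (Fin N → ℝ) → (Fin N → ℝ → EuclideanSpace ℝ (Fin 3)) → EuclideanSpace ℝ (Fin 3) → EuclideanSpace ℝ (Fin 3)) (D : (Fin N → ℝ) → Fin N → EuclideanSpace ℝ (Fin 3) → EuclideanSpace ℝ (Fin 3)) (C₀ M : ℝ) (U : (Fin N → ℝ) → EuclideanSpace ℝ (Fin 3) → EuclideanSpace ℝ (Fin 3)) (P : (Fin N → ℝ) → EuclideanSpace ℝ (Fin 3) → ℝ) (B : (Fin N → ℝ) → Fin N → ℝ) : Prop :=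
  ContinuousOn B {p:Fin N → ℝ | ∀ i, p i ∈ Icc 0 1} ∧ ∀ p:Fin N → ℝ, (∀ i, p i ∈ Icc 0 1) → U p ≠ 0 ∧ ContDiff ℝ (⊤:ℕ∞) (U p) ∧ ContDiff ℝ (⊤:ℕ∞) (P p) ∧ VectorCalculus.IsDivFree (U p)∧(∀ y, α p•(cross (EuclideanSpace.single 2 1) (U p y)-fderiv ℝ (U p) y (cross (EuclideanSpace.single 2 1) y))+(1/2:ℝ)•U p y+(1/2:ℝ)•fderiv ℝ (U p) y y-(Laplacian.laplacian (U p)) y+fderiv ℝ (U p) y (U p y)+gradient (P p) y = ∑ j, B p j•D p j y)∧(∀ y, ‖U p y‖≤C₀/(1+‖y‖))∧(∀ y, |P p y|≤M)∧(∀ y, ‖y‖≤Rw*√Γ → (∀ j τ, ρ*√Γ/4≤‖y-X p j τ‖) → ‖U p y-u p (X p) y‖≤η*√Γ)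

/-- Sanity (definitional unfolding only): the crux IS
`∀ consts, pos → ∃ Γ₁, ∀ Γ ≥ Γ₁, ∀ data, DefU → DefV → DefA → DefT → DefD → BoxClausesJ → ∃ family, AdmissibleJ`. [folklore] -/
theorem transverseReductionRJ_iff :
    TransverseReductionRJ ↔ (∀ (N:ℕ) (δ ρ K Λ a b cnd η Rw Rb cg θ₀:ℝ), 0 < N → 0 < δ → 0 < ρ → 0 ≤ a → 0 < η → 0 < Rw → 0 < Rb → 0 < cg → 0 < θ₀ → ∃ Γ₁:ℝ, ∀ Γ:ℝ, Γ₁≤Γ → ∀ (γ:(Fin N→ℝ) → Fin N → ℝ) (α:(Fin N→ℝ) → ℝ) (X:(Fin N→ℝ) → Fin N → ℝ → EuclideanSpace ℝ (Fin 3)) (w:(Fin N→ℝ) → Fin N → ℝ → ℝ) (c:(Fin N→ℝ) → Fin N → ℝ) (m n:(Fin N→ℝ) → Fin N → EuclideanSpace ℝ (Fin 3)) (u:(Fin N→ℝ)→(Fin N → ℝ → EuclideanSpace ℝ (Fin 3)) → EuclideanSpace ℝ (Fin 3) → EuclideanSpace ℝ (Fin 3)) (v:(Fin N→ℝ) → EuclideanSpace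 ℝ (Fin 3) → EuclideanSpace ℝ (Fin 3)) (A:(Fin N→ℝ) → Fin N → (EuclideanSpace ℝ (Fin 3) →L[ℝ] EuclideanSpace ℝ (Fin 3))) (T:(Fin N→ℝ)→(Fin N → ℝ → EuclideanSpace ℝ (Fin 3)) → Fin N → ℝ → EuclideanSpace ℝ (Fin 3)) (D:(Fin N→ℝ) → Fin N → EuclideanSpace ℝ (Fin 3) → EuclideanSpace ℝ (Fin 3)), DefU N Γ γ u → DefV N α X u v → DefA N X c v A → DefT N α u T → DefD N X c D → BoxClausesJ N Γ δ ρ K Λ a b cnd Rw Rb cg θ₀ γ α X w c m n v A T → ∃ (C₀ M:ℝ) (U:(Fin N→ℝ) → EuclideanSpace ℝ (Fin 3) → EuclideanSpace ℝ (Fin 3)) (P:(Fin N→ℝ) → EuclideanSpace ℝ (Fin 3) → ℝ) (B:(Fin N→ℝ) → Fin N → ℝ), AdmissibleJ N Γ ρ η Rw α X u D C₀ M U P B) :=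
  Iff.rfl


/-! ## 2. Analytic vocabulary of the line (the only NEW definitions; §1 is the crux verbatim)

Units are the crux's (absolute).  Tubes carry circulation `Γγ_pj` with `O(1)` cores, so a dressed skeleton has velocity
`O(Γ)` at the cores and frame velocities `O(√Γ)` at the window scale `|y| ~ √Γ`; every constant below may be POLYNOMIAL
in `Γ`.  The line is organised so that only polynomial losses occur (stub S2) and the dressing (stub S1) pays for them to
any order (stub S3 picks the order). -/

/-- Pointwise rotating-Leray PROFILE OPERATOR (velocity part; the pressure gradient is added separately):
`E_α(U)(y) = α (e₃ × U(y) − DU(y)[e₃ × y]) + ½ U(y) + ½ DU(y)[y] − ΔU(y) + DU(y)[U(y)]` — the left side of the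
crux's profile equation, in the crux's own pointwise vocabulary (`fderiv`, `Laplacian.laplacian`, `cross`, `gradient`). -/
def lerayOp (α : ℝ) (U : EuclideanSpace ℝ (Fin 3) → EuclideanSpace ℝ (Fin 3)) (y : EuclideanSpace ℝ (Fin 3)) : EuclideanSpace ℝ (Fin 3) :=
  α • (cross (EuclideanSpace.single 2 1) (U y) - fderiv ℝ U y (cross (EuclideanSpace.single 2 1) y)) + (1/2:ℝ) • U y + (1/2:ℝ) • fderiv ℝ U y y - (Laplacian.laplacian U) y + fderiv ℝ U y (U y)

/-- Its LINEARISATION at a base field `U⁰`: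
`𝓛_(α,U⁰) W (y) = α (e₃ × W − DW[e₃ × y]) + ½ W + ½ DW[y] − ΔW + DW[U⁰] + DU⁰[W]`
(so that `E_α(U⁰ + W) = E_α(U⁰) + 𝓛 W + DW[W]` pointwise for differentiable fields). -/
def lerayLin (α : ℝ) (U0 W : EuclideanSpace ℝ (Fin 3) → EuclideanSpace ℝ (Fin 3)) (y : EuclideanSpace ℝ (Fin 3)) : EuclideanSpace ℝ (Fin 3) :=
  α • (cross (EuclideanSpace.single 2 1) (W y) - fderiv ℝ W y (cross (EuclideanSpace.single 2 1) y)) + (1/2:ℝ) • W y + (1/2:ℝ) • fderiv ℝ W y y - (Laplacian.laplacian W) y + fderiv ℝ W y (U0 y) + fderiv ℝ U0 y (W y)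

/-- X-scale (velocity-type fields): `W ∈ C²` and `⟨y⟩·|W|, ⟨y⟩·|DW|, ⟨y⟩·|D²W| ≤ R` pointwise, `⟨y⟩ = 1 + |y|`
(`|y|⁻¹` is the scaling-neutral tail of `½ + ½ y·∇` and the decay class of the crux's conclusion).  Sup-type sizes are
pointwise inequalities with an explicit constant: no `⨆`, no junk value. -/
def XBound (W : EuclideanSpace ℝ (Fin 3) → EuclideanSpace ℝ (Fin 3)) (R : ℝ) : Prop :=
  ContDiff ℝ 2 W ∧ ∀ y, (1 + ‖y‖) * ‖W y‖ ≤ R ∧ (1 + ‖y‖) * ‖fderiv ℝ W y‖ ≤ R ∧ (1 + ‖y‖) * ‖iteratedFDeriv ℝ 2 W y‖ ≤ R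

/-- Y-scale (forcing-type fields): `F ∈ C¹` and `⟨y⟩²·|F|, ⟨y⟩²·|DF| ≤ R` pointwise (one derivative, so that `C²`
solutions are the natural output of an elliptic right inverse; `⟨y⟩⁻²` is the decay of `DW[W]` for `W` in the X-scale). -/
def YBound (F : EuclideanSpace ℝ (Fin 3) → EuclideanSpace ℝ (Fin 3)) (R : ℝ) : Prop :=
  ContDiff ℝ 1 F ∧ ∀ y, (1 + ‖y‖) ^ 2 * ‖F y‖ ≤ R ∧ (1 + ‖y‖) ^ 2 * ‖fderiv ℝ F y‖ ≤ R

/-- Local `C¹` closeness on the ball `|y| ≤ L` — the topology in which families may depend continuously on the box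
parameter `p` (clause 0 gives joint continuity of the skeleton in `(p, τ)` only: far tails move, so GLOBAL weighted
continuity in `p` is not available and is never asked for). -/
def LocClose (W W' : EuclideanSpace ℝ (Fin 3) → EuclideanSpace ℝ (Fin 3)) (L ε : ℝ) : Prop :=
  ∀ y, ‖y‖ ≤ L → ‖W y - W' y‖ ≤ ε ∧ ‖fderiv ℝ W y - fderiv ℝ W' y‖ ≤ ε

/-- Residual of a candidate base family MODULO the accretion modes:
`r_p(y) = E_(α_p)(U⁰_p)(y) + ∇P⁰_p(y) − Σ_j b⁰_pj · D_pj(y)`. -/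
def baseRes {N : ℕ} (α : (Fin N → ℝ) → ℝ) (D : (Fin N → ℝ) → Fin N → EuclideanSpace ℝ (Fin 3) → EuclideanSpace ℝ (Fin 3)) (U0 : (Fin N → ℝ) → EuclideanSpace ℝ (Fin 3) → EuclideanSpace ℝ (Fin 3)) (P0 : (Fin N → ℝ) → EuclideanSpace ℝ (Fin 3) → ℝ) (b0 : (Fin N → ℝ) → Fin N → ℝ) (p : Fin N → ℝ) (y : EuclideanSpace ℝ (Fin 3)) : EuclideanSpace ℝ (Fin 3) :=
  lerayOp (α p) (U0 p) y + gradient (P0 p) y - ∑ j, b0 p j • D p j y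

/-- **D2 · DRESSED BASE FAMILY of order `k`** (the spec stub S1 produces and stubs S2, S3 consume).
`p ↦ (U⁰_p, P⁰_p, b⁰_p)` on the cube: smooth, divergence-free, of polynomial size `Cs·Γ⁴` in the X-scale (pressure and
multipliers bounded likewise), NON-DEGENERATE (`|U⁰_p(y₀)| ≥ 1` somewhere), `η√Γ/2`-close to the skeleton field `u_p(X_p)`
off the `ρ√Γ/4`-tubes inside the waist ball (half the crux's tolerance), residual modulo accretion modes of Y-size
`≤ Cr·Γ^(−k)`, multipliers continuous on the cube, and `U⁰_p`, `r_p` locally continuous in `p`. -/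
def BaseSpec (N : ℕ) (Γ ρ η Rw : ℝ) (k : ℕ) (Cs Cr : ℝ) (α : (Fin N → ℝ) → ℝ) (X : (Fin N → ℝ) → Fin N → ℝ → EuclideanSpace ℝ (Fin 3)) (u : (Fin N → ℝ) → (Fin N → ℝ → EuclideanSpace ℝ (Fin 3)) → EuclideanSpace ℝ (Fin 3) → EuclideanSpace ℝ (Fin 3)) (D : (Fin N → ℝ) → Fin N → EuclideanSpace ℝ (Fin 3) → EuclideanSpace ℝ (Fin 3)) (U0 : (Fin N → ℝ) → EuclideanSpace ℝ (Fin 3) → EuclideanSpace ℝ (Fin 3)) (P0 : (Fin N → ℝ) → EuclideanSpace ℝ (Fin 3) → ℝ) (b0 : (Fin N → ℝ) → Fin N → ℝ) : Prop :=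
  ContinuousOn b0 {p : Fin N → ℝ | ∀ i, p i ∈ Icc 0 1} ∧
  ∀ p : Fin N → ℝ, (∀ i, p i ∈ Icc 0 1) →
    ContDiff ℝ (⊤:ℕ∞) (U0 p) ∧ ContDiff ℝ (⊤:ℕ∞) (P0 p) ∧ VectorCalculus.IsDivFree (U0 p) ∧
    XBound (U0 p) (Cs * Γ ^ 4) ∧ (∀ y, |P0 p y| ≤ Cs * Γ ^ 4) ∧ (∀ j, |b0 p j| ≤ Cs * Γ ^ 4) ∧
    (∃ y₀, 1 ≤ ‖U0 p y₀‖) ∧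
    (∀ y, ‖y‖ ≤ Rw * √Γ → (∀ j τ, ρ * √Γ / 4 ≤ ‖y - X p j τ‖) → ‖U0 p y - u p (X p) y‖ ≤ η * √Γ / 2) ∧
    YBound (baseRes α D U0 P0 b0 p) (Cr * Γ ^ (-(k:ℝ))) ∧
    (∀ L ε : ℝ, 0 < ε → ∃ δ' : ℝ, 0 < δ' ∧ ∀ q : Fin N → ℝ, (∀ i, q i ∈ Icc 0 1) → dist q p < δ' →
        LocClose (U0 q) (U0 p) L ε ∧ ∀ y, ‖y‖ ≤ L → ‖baseRes α D U0 P0 b0 q y - baseRes α D U0 P0 b0 p y‖ ≤ ε)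

/-- **D3 · POLYNOMIAL KELVIN GATE** (the spec stub S2 produces and stub S3 consumes): a RIGHT INVERSE
`F ↦ (W, Q, b) = (𝓚_p F, 𝓠_p F, 𝓑_p F)` of the linearised profile operator MODULO THE ACCRETION MODES,
`𝓛_(α_p, U⁰_p) W + ∇Q = F + Σ_j b_j D_pj`, `div W = 0`, with the POLYNOMIAL bound
`X-size(W), |Q|, |b| ≤ C₂ Γ^κ · Y-size(F)`; linear on Y-bounded data; TIGHT (uniformly Y-bounded forcings that are small
on a large ball give locally small response and small multipliers); locally continuous in `p` for fixed data.  The `N`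
accretion modes are the ONLY extra forcing directions, exactly as in the crux's conclusion (no rotation-generator
direction; see the line card §Rate for why, and what the gate therefore asserts about the rotation cokernel). -/
def GateSpec (N : ℕ) (Γ κ C₂ : ℝ) (α : (Fin N → ℝ) → ℝ) (D : (Fin N → ℝ) → Fin N → EuclideanSpace ℝ (Fin 3) → EuclideanSpace ℝ (Fin 3)) (U0 : (Fin N → ℝ) → EuclideanSpace ℝ (Fin 3) → EuclideanSpace ℝ (Fin 3)) (𝓚 : (Fin N → ℝ) → (EuclideanSpace ℝ (Fin 3) → EuclideanSpace ℝ (Fin 3)) → EuclideanSpace ℝ (Fin 3) → EuclideanSpace ℝ (Fin 3)) (𝓠 : (Fin N → ℝ) → (EuclideanSpace ℝ (Fin 3) → EuclideanSpace ℝ (Fin 3)) → EuclideanSpace ℝ (Fin 3) → ℝ) (𝓑 : (Fin N → ℝ) → (EuclideanSpace ℝ (Fin 3) → EuclideanSpace ℝ (Fin 3)) → Fin N → ℝ) : Prop :=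
  ∀ p : Fin N → ℝ, (∀ i, p i ∈ Icc 0 1) →
    (∀ (F : EuclideanSpace ℝ (Fin 3) → EuclideanSpace ℝ (Fin 3)) (R : ℝ), YBound F R →
        XBound (𝓚 p F) (C₂ * Γ ^ κ * R) ∧ ContDiff ℝ 1 (𝓠 p F) ∧ (∀ y, |𝓠 p F y| ≤ C₂ * Γ ^ κ * R) ∧ (∀ j, |𝓑 p F j| ≤ C₂ * Γ ^ κ * R) ∧
        VectorCalculus.IsDivFree (𝓚 p F) ∧
        ∀ y, lerayLin (α p) (U0 p) (𝓚 p F) y + gradient (𝓠 p F) y = F y + ∑ j, 𝓑 p F j • D p j y) ∧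
    (∀ (F G : EuclideanSpace ℝ (Fin 3) → EuclideanSpace ℝ (Fin 3)) (s : ℝ), (∃ R, YBound F R) → (∃ R, YBound G R) →
        (𝓚 p (fun y => F y + s • G y) = fun y => 𝓚 p F y + s • 𝓚 p G y) ∧ (𝓑 p (fun y => F y + s • G y) = fun j => 𝓑 p F j + s * 𝓑 p G j)) ∧
    (∀ R L ε : ℝ, 0 < ε → ∃ L' δ₀ : ℝ, 0 < δ₀ ∧ ∀ F : EuclideanSpace ℝ (Fin 3) → EuclideanSpace ℝ (Fin 3), YBound F R → (∀ y, ‖y‖ ≤ L' → ‖F y‖ ≤ δ₀) →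
        (∀ y, ‖y‖ ≤ L → ‖𝓚 p F y‖ ≤ ε ∧ ‖fderiv ℝ (𝓚 p F) y‖ ≤ ε) ∧ ∀ j, |𝓑 p F j| ≤ ε) ∧
    (∀ (F : EuclideanSpace ℝ (Fin 3) → EuclideanSpace ℝ (Fin 3)) (R L ε : ℝ), YBound F R → 0 < ε → ∃ δ' : ℝ, 0 < δ' ∧ ∀ q : Fin N → ℝ, (∀ i, q i ∈ Icc 0 1) → dist q p < δ' →
        LocClose (𝓚 q F) (𝓚 p F) L ε ∧ ∀ j, |𝓑 q F j - 𝓑 p F j| ≤ ε)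

/-- The crux's conclusion block with FINITE regularity (`U_p ∈ C²`, `P_p ∈ C¹`): what the fixed point of stub S3 delivers
before elliptic smoothing (stub S4); otherwise VERBATIM `AdmissibleJ`. -/
def AlmostAdmissibleJ (N : ℕ) (Γ ρ η Rw : ℝ) (α : (Fin N → ℝ) → ℝ) (X : (Fin N → ℝ) → Fin N → ℝ → EuclideanSpace ℝ (Fin 3)) (u : (Fin N → ℝ) → (Fin N → ℝ → EuclideanSpace ℝ (Fin 3)) → EuclideanSpace ℝ (Fin 3) → EuclideanSpace ℝ (Fin 3)) (D : (Fin N → ℝ) → Fin N → EuclideanSpace ℝ (Fin 3) → EuclideanSpace ℝ (Fin 3)) (C₀ M : ℝ) (U : (Fin N → ℝ) → EuclideanSpace ℝ (Fin 3) → EuclideanSpace ℝ (Fin 3)) (P : (Fin N → ℝ) → EuclideanSpace ℝ (Fin 3) → ℝ) (B : (Fin N → ℝ) → Fin N → ℝ) : Prop :=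
  ContinuousOn B {p:Fin N → ℝ | ∀ i, p i ∈ Icc 0 1} ∧ ∀ p:Fin N → ℝ, (∀ i, p i ∈ Icc 0 1) → U p ≠ 0 ∧ ContDiff ℝ 2 (U p) ∧ ContDiff ℝ 1 (P p) ∧ VectorCalculus.IsDivFree (U p)∧(∀ y, α p•(cross (EuclideanSpace.single 2 1) (U p y)-fderiv ℝ (U p) y (cross (EuclideanSpace.single 2 1) y))+(1/2:ℝ)•U p y+(1/2:ℝ)•fderiv ℝ (U p) y y-(Laplacian.laplacian (U p)) y+fderiv ℝ (U p) y (U p y)+gradient (P p) y = ∑ j, B p j•D p j y)∧(∀ y, ‖U p y‖≤C₀/(1+‖y‖))∧(∀ y, |P p y|≤M)∧(∀ y, ‖y‖≤Rw*√Γ → (∀ j τ, ρ*√Γ/4≤‖y-X p j τ‖) → ‖U p y-u p (X p) y‖≤η*√Γ)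

/-! ## 3. The four stub STATEMENTS (S1 dressing · S2 gate · S3 closing · S4 smoothing) -/

/-- Statement of stub S1 · `DressedSkeletonAllOrders` (size XL; classical-type matched asymptotics): for every order `k`
the box skeleton can be DRESSED into a base family of order `k` (spec `BaseSpec`), its size constant `Cs` uniform in `k`. -/
def DressedSkeletonAllOrders : Prop :=
  ∀ (N : ℕ) (δ ρ K Λ a b cnd η Rw Rb cg θ₀ : ℝ), 0 < N → 0 < δ → 0 < ρ → 0 ≤ a → 0 < η → 0 < Rw → 0 < Rb → 0 < cg → 0 < θ₀ →
    ∃ Cs : ℝ, ∀ k : ℕ, ∃ Cr Γ₁ : ℝ, ∀ Γ : ℝ, Γ₁ ≤ Γ → ∀ (γ : (Fin N → ℝ) → Fin N → ℝ) (α : (Fin N → ℝ) → ℝ) (X : (Fin N → ℝ) → Fin N → ℝ → EuclideanSpace ℝ (Fin 3)) (w : (Fin N → ℝ) → Fin N → ℝ → ℝ) (c : (Fin N → ℝ) → Fin N → ℝ) (m : (Fin N → ℝ) → Fin N → EuclideanSpace ℝ (Fin 3)) (n : (Fin N → ℝ) → Fin N → EuclideanSpace ℝ (Fin 3)) (u :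 (Fin N → ℝ) → (Fin N → ℝ → EuclideanSpace ℝ (Fin 3)) → EuclideanSpace ℝ (Fin 3) → EuclideanSpace ℝ (Fin 3)) (v : (Fin N → ℝ) → EuclideanSpace ℝ (Fin 3) → EuclideanSpace ℝ (Fin 3)) (A : (Fin N → ℝ) → Fin N → (EuclideanSpace ℝ (Fin 3) →L[ℝ] EuclideanSpace ℝ (Fin 3))) (T : (Fin N → ℝ) → (Fin N → ℝ → EuclideanSpace ℝ (Fin 3)) → Fin N → ℝ → EuclideanSpace ℝ (Fin 3)) (D : (Fin N → ℝ) → Fin N → EuclideanSpace ℝ (Fin 3) → EuclideanSpace ℝ (Fin 3)),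
      DefU N Γ γ u → DefV N α X u v → DefA N X c v A → DefT N α u T → DefD N X c D → BoxClausesJ N Γ δ ρ K Λ a b cnd Rw Rb cg θ₀ γ α X w c m n v A T →
      ∃ (U0 : (Fin N → ℝ) → EuclideanSpace ℝ (Fin 3) → EuclideanSpace ℝ (Fin 3)) (P0 : (Fin N → ℝ) → EuclideanSpace ℝ (Fin 3) → ℝ) (b0 : (Fin N → ℝ) → Fin N → ℝ), BaseSpec N Γ ρ η Rw k Cs Cr α X u D U0 P0 b0

/-- Statement of stub S2 · `PolynomialKelvinGate` (size XL; KILL-FIRST, HARDEST): around EVERY dressed base family of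
any order `k ≥ 1` and size `Cs` there is a polynomial Kelvin gate (spec `GateSpec`) with exponent `κ` and constant `C₂`
depending on the box constants and `Cs` only — not on `Γ`, `p`, the data, or `k`. -/
def PolynomialKelvinGate : Prop :=
  ∀ (N : ℕ) (δ ρ K Λ a b cnd η Rw Rb cg θ₀ : ℝ), 0 < N → 0 < δ → 0 < ρ → 0 ≤ a → 0 < η → 0 < Rw → 0 < Rb → 0 < cg → 0 < θ₀ →
    ∀ Cs : ℝ, ∃ κ C₂ : ℝ, ∀ k : ℕ, 1 ≤ k → ∀ Cr : ℝ, ∃ Γ₁ : ℝ, ∀ Γ : ℝ, Γ₁ ≤ Γ → ∀ (γ : (Fin N → ℝ) → Fin N → ℝ) (α : (Fin N → ℝ) → ℝ) (X : (Fin N → ℝ) → Fin N → ℝ → EuclideanSpace ℝ (Fin 3)) (w : (Fin N → ℝ) → Fin N → ℝ → ℝ) (c : (Fin N → ℝ) → Fin N → ℝ) (m : (Fin N → ℝ) → Fin N → EuclideanSpace ℝ (Fin 3)) (n : (Fin N → ℝ) → Fin N → EuclideanSpace ℝ (Fin 3)) (u : (Fin N → ℝ) → (Fin N → ℝ → EuclideanSpace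 ℝ (Fin 3)) → EuclideanSpace ℝ (Fin 3) → EuclideanSpace ℝ (Fin 3)) (v : (Fin N → ℝ) → EuclideanSpace ℝ (Fin 3) → EuclideanSpace ℝ (Fin 3)) (A : (Fin N → ℝ) → Fin N → (EuclideanSpace ℝ (Fin 3) →L[ℝ] EuclideanSpace ℝ (Fin 3))) (T : (Fin N → ℝ) → (Fin N → ℝ → EuclideanSpace ℝ (Fin 3)) → Fin N → ℝ → EuclideanSpace ℝ (Fin 3)) (D : (Fin N → ℝ) → Fin N → EuclideanSpace ℝ (Fin 3) → EuclideanSpace ℝ (Fin 3)),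
      DefU N Γ γ u → DefV N α X u v → DefA N X c v A → DefT N α u T → DefD N X c D → BoxClausesJ N Γ δ ρ K Λ a b cnd Rw Rb cg θ₀ γ α X w c m n v A T →
      ∀ (U0 : (Fin N → ℝ) → EuclideanSpace ℝ (Fin 3) → EuclideanSpace ℝ (Fin 3)) (P0 : (Fin N → ℝ) → EuclideanSpace ℝ (Fin 3) → ℝ) (b0 : (Fin N → ℝ) → Fin N → ℝ), BaseSpec N Γ ρ η Rw k Cs Cr α X u D U0 P0 b0 →
      ∃ (𝓚 : (Fin N → ℝ) → (EuclideanSpace ℝ (Fin 3) → EuclideanSpace ℝ (Fin 3)) → EuclideanSpace ℝ (Fin 3) → EuclideanSpace ℝ (Fin 3)) (𝓠 : (Fin N → ℝ) → (EuclideanSpace ℝ (Fin 3) → EuclideanSpace ℝ (Fin 3)) → EuclideanSpace ℝ (Fin 3) → ℝ) (𝓑 : (Fin N → ℝ) → (EuclideanSpace ℝ (Fin 3) → EuclideanSpace ℝ (Fin 3)) → Fin N → ℝ), GateSpec N Γ κ C₂ α D U0 𝓚 𝓠 𝓑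

/-- Statement of stub S3 · `NonlinearClosing` (size L; parametrised contraction + admissibility bookkeeping): given the
gate's `κ, C₂` and the size `Cs`, SOME dressing order `k` suffices: for every dressed base family of that order and every
gate around it, the fixed point `W_p = 𝓚_p(−r_p − DW_p[W_p])` exists for `Γ ≥ Γ₁` and `U_p = U⁰_p + W_p`,
`P_p = P⁰_p + 𝓠_p(…)`, `B_p = b⁰_p + 𝓑_p(…)` is an admissible reduced family with `C²/C¹` regularity (`AlmostAdmissibleJ`). -/
def NonlinearClosing : Prop :=
  ∀ (N : ℕ) (δ ρ K Λ a b cnd η Rw Rb cg θ₀ : ℝ), 0 < N → 0 < δ → 0 < ρ → 0 ≤ a → 0 < η → 0 < Rw → 0 < Rb → 0 < cg → 0 < θ₀ →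
    ∀ Cs κ C₂ : ℝ, ∃ k : ℕ, 1 ≤ k ∧ ∀ Cr : ℝ, ∃ Γ₁ : ℝ, ∀ Γ : ℝ, Γ₁ ≤ Γ → ∀ (γ : (Fin N → ℝ) → Fin N → ℝ) (α : (Fin N → ℝ) → ℝ) (X : (Fin N → ℝ) → Fin N → ℝ → EuclideanSpace ℝ (Fin 3)) (w : (Fin N → ℝ) → Fin N → ℝ → ℝ) (c : (Fin N → ℝ) → Fin N → ℝ) (m : (Fin N → ℝ) → Fin N → EuclideanSpace ℝ (Fin 3)) (n : (Fin N → ℝ) → Fin N → EuclideanSpace ℝ (Fin 3)) (u : (Fin N → ℝ) → (Fin N → ℝ → EuclideanSpace ℝ (Fin 3)) → EuclideanSpace ℝ (Fin 3) → EuclideanSpace ℝ (Fin 3)) (v : (Fin N → ℝ) → EuclideanSpace ℝ (Fin 3) → EuclideanSpace ℝ (Fin 3)) (A : (Fin N → ℝ) → Fin N → (EuclideanSpace ℝ (Fin 3) →L[ℝ] EuclideanSpace ℝ (Fin 3))) (T : (Fin N → ℝ) → (Fin N → ℝ → EuclideanSpace ℝ (Fin 3)) → Fin N → ℝ → EuclideanSpace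 ℝ (Fin 3)) (D : (Fin N → ℝ) → Fin N → EuclideanSpace ℝ (Fin 3) → EuclideanSpace ℝ (Fin 3)),
      DefU N Γ γ u → DefV N α X u v → DefA N X c v A → DefT N α u T → DefD N X c D → BoxClausesJ N Γ δ ρ K Λ a b cnd Rw Rb cg θ₀ γ α X w c m n v A T →
      ∀ (U0 : (Fin N → ℝ) → EuclideanSpace ℝ (Fin 3) → EuclideanSpace ℝ (Fin 3)) (P0 : (Fin N → ℝ) → EuclideanSpace ℝ (Fin 3) → ℝ) (b0 : (Fin N → ℝ) → Fin N → ℝ), BaseSpec N Γ ρ η Rw k Cs Cr α X u D U0 P0 b0 →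
      ∀ (𝓚 : (Fin N → ℝ) → (EuclideanSpace ℝ (Fin 3) → EuclideanSpace ℝ (Fin 3)) → EuclideanSpace ℝ (Fin 3) → EuclideanSpace ℝ (Fin 3)) (𝓠 : (Fin N → ℝ) → (EuclideanSpace ℝ (Fin 3) → EuclideanSpace ℝ (Fin 3)) → EuclideanSpace ℝ (Fin 3) → ℝ) (𝓑 : (Fin N → ℝ) → (EuclideanSpace ℝ (Fin 3) → EuclideanSpace ℝ (Fin 3)) → Fin N → ℝ), GateSpec N Γ κ C₂ α D U0 𝓚 𝓠 𝓑 →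
      ∃ (C₀ M : ℝ) (U : (Fin N → ℝ) → EuclideanSpace ℝ (Fin 3) → EuclideanSpace ℝ (Fin 3)) (P : (Fin N → ℝ) → EuclideanSpace ℝ (Fin 3) → ℝ) (B : (Fin N → ℝ) → Fin N → ℝ), AlmostAdmissibleJ N Γ ρ η Rw α X u D C₀ M U P B

/-- Statement of stub S4 · `EllipticSmoothing` (size M–L; interior regularity for the forced steady profile system): a `C²`
divergence-free velocity with `C¹` pressure solving the profile equation with accretion-mode forcing is `C^∞` (and so is
the pressure).  The accretion modes `D_pj` (defining hypothesis 5, unit tangent by clause 3) are real-analytic fields. -/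
def EllipticSmoothing : Prop :=
  ∀ (N : ℕ) (Γ δ ρ K Λ a b cnd Rw Rb cg θ₀ : ℝ) (γ : (Fin N → ℝ) → Fin N → ℝ) (α : (Fin N → ℝ) → ℝ) (X : (Fin N → ℝ) → Fin N → ℝ → EuclideanSpace ℝ (Fin 3)) (w : (Fin N → ℝ) → Fin N → ℝ → ℝ) (c : (Fin N → ℝ) → Fin N → ℝ) (m : (Fin N → ℝ) → Fin N → EuclideanSpace ℝ (Fin 3)) (n : (Fin N → ℝ) → Fin N → EuclideanSpace ℝ (Fin 3)) (u : (Fin N → ℝ) → (Fin N → ℝ → EuclideanSpace ℝ (Fin 3)) → EuclideanSpace ℝ (Fin 3) → EuclideanSpace ℝ (Fin 3)) (v : (Fin N → ℝ) → EuclideanSpace ℝ (Fin 3) → EuclideanSpace ℝ (Fin 3)) (A : (Fin N → ℝ) → Fin N → (EuclideanSpace ℝ (Fin 3) →L[ℝ] EuclideanSpace ℝ (Fin 3))) (T : (Fin N → ℝ) → (Fin N → ℝ → EuclideanSpace ℝ (Fin 3)) → Fin N → ℝ → EuclideanSpace ℝ (Fin 3)) (D : (Fin N → ℝ) → Fin N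 → EuclideanSpace ℝ (Fin 3) → EuclideanSpace ℝ (Fin 3)),
    DefD N X c D → BoxClausesJ N Γ δ ρ K Λ a b cnd Rw Rb cg θ₀ γ α X w c m n v A T →
    ∀ p : Fin N → ℝ, (∀ i, p i ∈ Icc 0 1) → ∀ (U : EuclideanSpace ℝ (Fin 3) → EuclideanSpace ℝ (Fin 3)) (P : EuclideanSpace ℝ (Fin 3) → ℝ) (B : Fin N → ℝ),
      ContDiff ℝ 2 U → ContDiff ℝ 1 P → VectorCalculus.IsDivFree U →
      (∀ y, α p•(cross (EuclideanSpace.single 2 1) (U y)-fderiv ℝ (U) y (cross (EuclideanSpace.single 2 1) y))+(1/2:ℝ)•U y+(1/2:ℝ)•fderiv ℝ (U) y y-(Laplacian.laplacian (U)) y+fderiv ℝ (U) y (U y)+gradient (P) y = ∑ j, B j•D p j y) →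
      ContDiff ℝ (⊤:ℕ∞) U ∧ ContDiff ℝ (⊤:ℕ∞) P

/-! ## 4. The kernel-checked composition (no stub is asserted in this file) -/

/-- **Composition (pure logic, no sorry).**  Dressing + gate + closing + smoothing give `TransverseReductionRJ` BY NAME:
constants in the order `Cs` (S1) → `κ, C₂` (S2) → `k` (S3) → `Cr` (S1 at `k`) → the three thresholds → `Γ₁ = max`. -/
theorem TransverseReductionRJ_of (h1 : DressedSkeletonAllOrders) (h2 : PolynomialKelvinGate) (h3 : NonlinearClosing)
    (h4 : EllipticSmoothing) : TransverseReductionRJ := by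
  refine transverseReductionRJ_iff.mpr ?_
  intro N δ ρ K Λ a b cnd η Rw Rb cg θ₀ hN hδ hρ ha hη hRw hRb hcg hθ₀
  obtain ⟨Cs, hS1⟩ := h1 N δ ρ K Λ a b cnd η Rw Rb cg θ₀ hN hδ hρ ha hη hRw hRb hcg hθ₀
  obtain ⟨κ, C₂, hS2⟩ := h2 N δ ρ K Λ a b cnd η Rw Rb cg θ₀ hN hδ hρ ha hη hRw hRb hcg hθ₀ Cs
  obtain ⟨k, hk, hS3⟩ := h3 N δ ρ K Λ a b cnd η Rw Rb cg θ₀ hN hδ hρ ha hη hRw hRb hcg hθ₀ Cs κ C₂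
  obtain ⟨Cr, Γa, hS1'⟩ := hS1 k
  obtain ⟨Γb, hS2'⟩ := hS2 k hk Cr
  obtain ⟨Γc, hS3'⟩ := hS3 Cr
  refine ⟨max Γa (max Γb Γc), ?_⟩
  intro Γ hΓ γ α X w c m n u v A T D hu hv hA hT hD hbox
  have hΓa : Γa ≤ Γ := le_trans (le_max_left _ _) hΓ
  have hΓb : Γb ≤ Γ := le_trans (le_trans (le_max_left _ _) (le_max_right _ _)) hΓ
  have hΓc : Γc ≤ Γ := le_trans (le_trans (le_max_right _ _) (le_max_right _ _)) hΓ
  obtain ⟨U0, P0, b0, hbase⟩ := hS1' Γ hΓa γ α X w c m n u v A T D hu hv hA hT hD hbox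
  obtain ⟨𝓚, 𝓠, 𝓑, hgate⟩ := hS2' Γ hΓb γ α X w c m n u v A T D hu hv hA hT hD hbox U0 P0 b0 hbase
  obtain ⟨C₀, M, U, P, B, hB, hU⟩ := hS3' Γ hΓc γ α X w c m n u v A T D hu hv hA hT hD hbox U0 P0 b0 hbase 𝓚 𝓠 𝓑 hgate
  refine ⟨C₀, M, U, P, B, hB, fun p hp => ?_⟩
  obtain ⟨hne, hU2, hP1, hdiv, heq, hdec, hPM, hwin⟩ := hU p hp
  obtain ⟨hUs, hPs⟩ := h4 N Γ δ ρ K Λ a b cnd Rw Rb cg θ₀ γ α X w c m n u v A T D hD hbox p hp (U p) (P p) (B p) hU2 hP1 hdiv heq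
  exact ⟨hne, hUs, hPs, hdiv, heq, hdec, hPM, hwin⟩


/-! ## 5. v4 reshape DRAFT (appended 2026-08-28 by prover ns-filament-21221-p1 g5; NOT the registered line until the lead /
tenure planner adopts it): the quantifier prefixes of S2/S3 with a dressing-order threshold `k₀`

Rationale: `Theorems.KelvinGate.polynomialKelvinGate_iff_order_one` (file `…KelvinGateOrderOne`) shows the registered S2 is
equivalent to its `k = 1` restriction; the v4 prefix lets the gate name the order `k₀` from which it is demanded, and S3
accepts any such threshold.  Bodies after the prefix are VERBATIM those of `PolynomialKelvinGate` / `NonlinearClosing`.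
`TransverseReductionRJ_of_eventual` is the re-threaded composition (crux BY NAME); the two comparison lemmas record that v4
WEAKENS S2 (`k₀ := 1`) and STRENGTHENS S3 (`k₀ := 1`). -/

/-- Statement of stub S2 · `EventualKelvinGate` (size XL; KILL-FIRST, HARDEST): around EVERY dressed base family of
any SUFFICIENTLY HIGH order `k ≥ k₀` (the threshold `k₀` chosen together with the gate constants, after `Cs`) and size
`Cs` there is a polynomial Kelvin gate (spec `GateSpec`) with exponent `κ` and constant `C₂` depending on the box
constants and `Cs` only — not on `Γ`, `p`, the data, or `k`.  (v4: `∃ k₀` added; v3 `PolynomialKelvinGate` had `∀ k ≥ 1`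
and was thereby equivalent to its `k = 1` restriction, `Theorems.KelvinGate.polynomialKelvinGate_iff_order_one`.) -/
def EventualKelvinGate : Prop :=
  ∀ (N : ℕ) (δ ρ K Λ a b cnd η Rw Rb cg θ₀ : ℝ), 0 < N → 0 < δ → 0 < ρ → 0 ≤ a → 0 < η → 0 < Rw → 0 < Rb → 0 < cg → 0 < θ₀ →
    ∀ Cs : ℝ, ∃ κ C₂ : ℝ, ∃ k₀ : ℕ, ∀ k : ℕ, k₀ ≤ k → 1 ≤ k → ∀ Cr : ℝ, ∃ Γ₁ : ℝ, ∀ Γ : ℝ, Γ₁ ≤ Γ → ∀ (γ : (Fin N → ℝ) → Fin N → ℝ) (α : (Fin N → ℝ) → ℝ) (X : (Fin N → ℝ) → Fin N → ℝ → EuclideanSpace ℝ (Fin 3)) (w : (Fin N → ℝ) → Fin N → ℝ → ℝ) (c : (Fin N → ℝ) → Fin N → ℝ) (m : (Fin N → ℝ) → Fin N → EuclideanSpace ℝ (Fin 3)) (n : (Fin N → ℝ) → Fin N → EuclideanSpace ℝ (Fin 3)) (u : (Fin N → ℝ) → (Fin N → ℝ → EuclideanSpace ℝ (Fin 3)) →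 EuclideanSpace ℝ (Fin 3) → EuclideanSpace ℝ (Fin 3)) (v : (Fin N → ℝ) → EuclideanSpace ℝ (Fin 3) → EuclideanSpace ℝ (Fin 3)) (A : (Fin N → ℝ) → Fin N → (EuclideanSpace ℝ (Fin 3) →L[ℝ] EuclideanSpace ℝ (Fin 3))) (T : (Fin N → ℝ) → (Fin N → ℝ → EuclideanSpace ℝ (Fin 3)) → Fin N → ℝ → EuclideanSpace ℝ (Fin 3)) (D : (Fin N → ℝ) → Fin N → EuclideanSpace ℝ (Fin 3) → EuclideanSpace ℝ (Fin 3)),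
      DefU N Γ γ u → DefV N α X u v → DefA N X c v A → DefT N α u T → DefD N X c D → BoxClausesJ N Γ δ ρ K Λ a b cnd Rw Rb cg θ₀ γ α X w c m n v A T →
      ∀ (U0 : (Fin N → ℝ) → EuclideanSpace ℝ (Fin 3) → EuclideanSpace ℝ (Fin 3)) (P0 : (Fin N → ℝ) → EuclideanSpace ℝ (Fin 3) → ℝ) (b0 : (Fin N → ℝ) → Fin N → ℝ), BaseSpec N Γ ρ η Rw k Cs Cr α X u D U0 P0 b0 →
      ∃ (𝓚 : (Fin N → ℝ) → (EuclideanSpace ℝ (Fin 3) → EuclideanSpace ℝ (Fin 3)) → EuclideanSpace ℝ (Fin 3) → EuclideanSpace ℝ (Fin 3)) (𝓠 : (Fin N → ℝ) → (EuclideanSpace ℝ (Fin 3) → EuclideanSpace ℝ (Fin 3)) → EuclideanSpace ℝ (Fin 3) → ℝ) (𝓑 : (Fin N → ℝ) → (EuclideanSpace ℝ (Fin 3) → EuclideanSpace ℝ (Fin 3)) → Fin N → ℝ), GateSpec N Γ κ C₂ α D U0 𝓚 𝓠 𝓑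

/-- Statement of stub S3 · `NonlinearClosingFrom` (size L; parametrised contraction + admissibility bookkeeping): given the
gate's `κ, C₂`, the size `Cs` and ANY threshold `k₀`, SOME dressing order `k ≥ k₀` suffices: for every dressed base family
of that order and every gate around it, the fixed point `W_p = 𝓚_p(−r_p − DW_p[W_p])` exists for `Γ ≥ Γ₁` and
`U_p = U⁰_p + W_p`, `P_p = P⁰_p + 𝓠_p(…)`, `B_p = b⁰_p + 𝓑_p(…)` is an admissible reduced family with `C²/C¹` regularity
(`AlmostAdmissibleJ`).  (v4: `∀ k₀` added; the v3 `NonlinearClosing` proof route `k = max(k₀, ⌊2κ⌋ + 1)` is unchanged.) -/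
def NonlinearClosingFrom : Prop :=
  ∀ (N : ℕ) (δ ρ K Λ a b cnd η Rw Rb cg θ₀ : ℝ), 0 < N → 0 < δ → 0 < ρ → 0 ≤ a → 0 < η → 0 < Rw → 0 < Rb → 0 < cg → 0 < θ₀ →
    ∀ Cs κ C₂ : ℝ, ∀ k₀ : ℕ, ∃ k : ℕ, k₀ ≤ k ∧ 1 ≤ k ∧ ∀ Cr : ℝ, ∃ Γ₁ : ℝ, ∀ Γ : ℝ, Γ₁ ≤ Γ → ∀ (γ : (Fin N → ℝ) → Fin N → ℝ) (α : (Fin N → ℝ) → ℝ) (X : (Fin N → ℝ) → Fin N → ℝ → EuclideanSpace ℝ (Fin 3)) (w : (Fin N → ℝ) → Fin N → ℝ → ℝ) (c : (Fin N → ℝ) → Fin N → ℝ) (m : (Fin N → ℝ) → Fin N → EuclideanSpace ℝ (Fin 3)) (n : (Fin N → ℝ) → Fin N → EuclideanSpace ℝ (Fin 3)) (u : (Fin N → ℝ) → (Fin N → ℝ → EuclideanSpace ℝ (Fin 3)) → EuclideanSpace ℝ (Fin 3) → EuclideanSpace ℝ (Fin 3)) (v : (Fin N → ℝ) → EuclideanSpace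 ℝ (Fin 3) → EuclideanSpace ℝ (Fin 3)) (A : (Fin N → ℝ) → Fin N → (EuclideanSpace ℝ (Fin 3) →L[ℝ] EuclideanSpace ℝ (Fin 3))) (T : (Fin N → ℝ) → (Fin N → ℝ → EuclideanSpace ℝ (Fin 3)) → Fin N → ℝ → EuclideanSpace ℝ (Fin 3)) (D : (Fin N → ℝ) → Fin N → EuclideanSpace ℝ (Fin 3) → EuclideanSpace ℝ (Fin 3)),
      DefU N Γ γ u → DefV N α X u v → DefA N X c v A → DefT N α u T → DefD N X c D → BoxClausesJ N Γ δ ρ K Λ a b cnd Rw Rb cg θ₀ γ α X w c m n v A T →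
      ∀ (U0 : (Fin N → ℝ) → EuclideanSpace ℝ (Fin 3) → EuclideanSpace ℝ (Fin 3)) (P0 : (Fin N → ℝ) → EuclideanSpace ℝ (Fin 3) → ℝ) (b0 : (Fin N → ℝ) → Fin N → ℝ), BaseSpec N Γ ρ η Rw k Cs Cr α X u D U0 P0 b0 →
      ∀ (𝓚 : (Fin N → ℝ) → (EuclideanSpace ℝ (Fin 3) → EuclideanSpace ℝ (Fin 3)) → EuclideanSpace ℝ (Fin 3) → EuclideanSpace ℝ (Fin 3)) (𝓠 : (Fin N → ℝ) → (EuclideanSpace ℝ (Fin 3) → EuclideanSpace ℝ (Fin 3)) → EuclideanSpace ℝ (Fin 3) → ℝ) (𝓑 : (Fin N → ℝ) → (EuclideanSpace ℝ (Fin 3) → EuclideanSpace ℝ (Fin 3)) → Fin N → ℝ), GateSpec N Γ κ C₂ α D U0 𝓚 𝓠 𝓑 →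
      ∃ (C₀ M : ℝ) (U : (Fin N → ℝ) → EuclideanSpace ℝ (Fin 3) → EuclideanSpace ℝ (Fin 3)) (P : (Fin N → ℝ) → EuclideanSpace ℝ (Fin 3) → ℝ) (B : (Fin N → ℝ) → Fin N → ℝ), AlmostAdmissibleJ N Γ ρ η Rw α X u D C₀ M U P B

/-- **Composition for the v4 prefixes (pure logic, no sorry).**  Constants in the order `Cs` (S1) → `κ, C₂, k₀` (S2) →
`k ≥ k₀` (S3) → `Cr` (S1 at `k`) → the three thresholds → `Γ₁ = max`; the crux BY NAME. -/
theorem TransverseReductionRJ_of_eventual (h1 : DressedSkeletonAllOrders) (h2 : EventualKelvinGate) (h3 : NonlinearClosingFrom)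
    (h4 : EllipticSmoothing) : TransverseReductionRJ := by
  refine transverseReductionRJ_iff.mpr ?_
  intro N δ ρ K Λ a b cnd η Rw Rb cg θ₀ hN hδ hρ ha hη hRw hRb hcg hθ₀
  obtain ⟨Cs, hS1⟩ := h1 N δ ρ K Λ a b cnd η Rw Rb cg θ₀ hN hδ hρ ha hη hRw hRb hcg hθ₀
  obtain ⟨κ, C₂, k₀, hS2⟩ := h2 N δ ρ K Λ a b cnd η Rw Rb cg θ₀ hN hδ hρ ha hη hRw hRb hcg hθ₀ Cs
  obtain ⟨k, hk₀, hk, hS3⟩ := h3 N δ ρ K Λ a b cnd η Rw Rb cg θ₀ hN hδ hρ ha hη hRw hRb hcg hθ₀ Cs κ C₂ k₀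
  obtain ⟨Cr, Γa, hS1'⟩ := hS1 k
  obtain ⟨Γb, hS2'⟩ := hS2 k hk₀ hk Cr
  obtain ⟨Γc, hS3'⟩ := hS3 Cr
  refine ⟨max Γa (max Γb Γc), ?_⟩
  intro Γ hΓ γ α X w c m n u v A T D hu hv hA hT hD hbox
  have hΓa : Γa ≤ Γ := le_trans (le_max_left _ _) hΓ
  have hΓb : Γb ≤ Γ := le_trans (le_trans (le_max_left _ _) (le_max_right _ _)) hΓ
  have hΓc : Γc ≤ Γ := le_trans (le_trans (le_max_right _ _) (le_max_right _ _)) hΓ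
  obtain ⟨U0, P0, b0, hbase⟩ := hS1' Γ hΓa γ α X w c m n u v A T D hu hv hA hT hD hbox
  obtain ⟨𝓚, 𝓠, 𝓑, hgate⟩ := hS2' Γ hΓb γ α X w c m n u v A T D hu hv hA hT hD hbox U0 P0 b0 hbase
  obtain ⟨C₀, M, U, P, B, hB, hU⟩ := hS3' Γ hΓc γ α X w c m n u v A T D hu hv hA hT hD hbox U0 P0 b0 hbase 𝓚 𝓠 𝓑 hgate
  refine ⟨C₀, M, U, P, B, hB, fun p hp => ?_⟩
  obtain ⟨hne, hU2, hP1, hdiv, heq, hdec, hPM, hwin⟩ := hU p hp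
  obtain ⟨hUs, hPs⟩ := h4 N Γ δ ρ K Λ a b cnd Rw Rb cg θ₀ γ α X w c m n u v A T D hD hbox p hp (U p) (P p) (B p) hU2 hP1 hdiv heq
  exact ⟨hne, hUs, hPs, hdiv, heq, hdec, hPM, hwin⟩

/-- v4 WEAKENS S2: the registered `PolynomialKelvinGate` implies `EventualKelvinGate` (take `k₀ := 1`). -/
theorem eventualKelvinGate_of_polynomialKelvinGate (h : PolynomialKelvinGate) : EventualKelvinGate := by
  intro N δ ρ K Λ a b cnd η Rw Rb cg θ₀ hN hδ hρ ha hη hRw hRb hcg hθ₀ Cs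
  obtain ⟨κ, C₂, hk⟩ := h N δ ρ K Λ a b cnd η Rw Rb cg θ₀ hN hδ hρ ha hη hRw hRb hcg hθ₀ Cs
  exact ⟨κ, C₂, 1, fun k _ hk1 Cr => hk k hk1 Cr⟩

/-- v4 STRENGTHENS S3: `NonlinearClosingFrom` implies the registered `NonlinearClosing` (take `k₀ := 1`). -/
theorem nonlinearClosing_of_nonlinearClosingFrom (h : NonlinearClosingFrom) : NonlinearClosing := by
  intro N δ ρ K Λ a b cnd η Rw Rb cg θ₀ hN hδ hρ ha hη hRw hRb hcg hθ₀ Cs κ C₂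
  obtain ⟨k, -, hk1, hk⟩ := h N δ ρ K Λ a b cnd η Rw Rb cg θ₀ hN hδ hρ ha hη hRw hRb hcg hθ₀ Cs κ C₂ 1
  exact ⟨k, hk1, hk⟩

end Summit.NavierStokesRegularity.NavierStokesRegularity.Theorems.KelvinGate
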